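import Summits.BirchSwinnertonDyer.BirchSwinnertonDyer.Theorems.SmallImageMuTransferMuTransferX9LocalQTermNaturality
import HarnessLib

/-!
# K6 crux `MuTransferX9` (stmt-BirchSwinnertonDyer-19276), CORE-PLAN S4.3 on the genuine objects, file 4/5:
# the coefficient family of the `tr × ur` local cup product at an `E`-split prime, in VALUE coordinates,
# IS `u(T)·⟨·,·⟩_(A_J)` for some power series `u` (KOLY-MEMO §5.11.B (N1)+(N2)+(N4))

Cell `bsd-smallim`, seat `bsd-smallim-koly` gen 8 (route `SmallImageMuTransfer`, rung K6, leaf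
`Rank1Residual.BSDpOnClassX9`). HONEST FRAMING: TOOL theorems; no definition, no named fact, no `sorry`;
nothing is asserted about any curve and nothing is booked. Serves the registered stub `stub_stepsTwoFourX9`
of crux 19276 (skeleton v5 bbfcbeb8eb041500; the q-TERM of MU-TRANSFER-PROOF §5 STEP 4 = Lemma 1 (iii))
and credits nothing toward its closure (`--supports … --as helper`). PARTITION (D-0054): X9 (A4) ×
p ∈ {5, 7} · X10b∧¬Surj (A5) × p = 3 (everything is stated for an odd prime / any number field) — helper;
closes NONE.

## Content
* **`exists_inv_cupProduct_eq_sum_convCoeff`** — there is `u : ℕ → ℤ/p` with, for every `k < J`, every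
  cocycle `φ` of `𝒯_J|_q` with TRANSVERSE class and every cocycle `ψ` of `𝒯′_J|_q` vanishing on inertia,
  `inv_q(T^(J−1−k)[φ] ∪_P [ψ]) = Σ_(j ≤ k) u_j · ι(C_(k−j)(φ(t₀), ψ(Fr)))`.  Proof: parametrise transverse
  classes by `t ↦ X(t)` (value `T^s t`, `s = J ∸ p^m`, file 2) and unramified classes by `f ↦ Y(f)` (value
  `f` at `Fr`, file 1); the family `Φ_k(t, f) = inv_q(T^(J−1−k) X(t) ∪ Y(f))` is bi-additive,
  SHIFT-COMPATIBLE (`cupProduct_adjoint` for `S`, `gorensteinPairing_shiftEnd_comm`) and NATURAL for the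
  rank-one pairs `φ₀ = ι e(·, w₀)·a`, `φ₀′ = ι e(a, ·)·w₀` (file 3), hence `u(T)·Gorenstein` by koly g7's
  `family_eq_weightedConv`; `u_j = 0` for `j < s` and the re-indexing `sum_range_mul_shift_reindex` turn
  the parametrisation `t` into the VALUE `φ(t₀) = T^s t`.
The unit property `u_0 ≠ 0` is file 5 (`exists_unit_inv_cupProduct_eq_sum_convCoeff`).

References: B. Mazur, K. Rubin, Mem. AMS 799 (2004) Prop. 1.3.2 [MazurRubin2004]; B. Howard, Compositio
140 (2004) Prop. 3.2.4 [Howard2004HeegnerKolyvagin]; K. Rubin, PCMI 18 (2011) Prop. 1.9.5 [Rubin2011].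
-/

set_option linter.dupNamespace false
set_option autoImplicit false

noncomputable section

open scoped Classical ContRepresentation

universe u

namespace Summit.BirchSwinnertonDyer.BirchSwinnertonDyer.Rank1Residual.LocalSplitPrime

open CategoryTheory ContinuousCohomology Function Field ValuativeRel NumberField IsDedekindDomain Finset
open Literature.NumberTheory.GaloisRepresentations
open Literature.NumberTheory.GaloisRepresentations.IsNonarchimedeanLocalField
open _root_.TopRep
open Literature.NumberTheory.GaloisCohomology
open Literature.NumberTheory.EllipticCurves
open Summit.BirchSwinnertonDyer.Rank1Residual.GaloisImage
open Summit.BirchSwinnertonDyer.Rank1Residual (X11b.LocBridge.mem_unramifiedSubgroup_one_iff_forall_eq_zero)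

section QTerm

variable {K : Type u} [Field K] [NumberField K] {p : ℕ} [Fact p.Prime]
  {M M' : Type u} [AddCommGroup M] [TopologicalSpace M] [DiscreteTopology M] [Finite M]
  [AddCommGroup M'] [TopologicalSpace M'] [DiscreteTopology M'] [Finite M']
  (ρ : DiscreteGaloisModule K M) (ρ' : DiscreteGaloisModule K M')
  (hM : ∀ x : M, p • x = 0) (hM' : ∀ x : M', p • x = 0) (κ : ZpExtension K p) (J : ℕ)
  (q : HeightOneSpectrum (𝓞 K)) [Fact (Ideal.absNorm q.asIdeal).Prime]
  [NeZero ((Ideal.absNorm q.asIdeal : ℕ) : q.adicCompletion K)]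
  -- cup products on `Γ_{K_q}` need `LocallyCompactSpace` (a `Prop`; the tree's theorem
  -- `absoluteGaloisGroup_compactSpace` provides it — taken as an instance binder, as in x10's StepFour files)
  [LocallyCompactSpace (absoluteGaloisGroup (q.adicCompletion K))]

set_option maxHeartbeats 400000 in
/-- **The `tr × ur` local cup product in value coordinates is `u(T)·⟨·,·⟩_{A_J}` for SOME `u`**
(KOLY-MEMO §5.11.B (N1)+(N2)+(N4): shift-compatibility + rank-one naturality + `family_eq_weightedConv`);
the unit property `u_0 ≠ 0` is added in `exists_unit_inv_cupProduct_eq_sum_convCoeff` from perfectness.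
See that theorem for the dictionary of hypotheses. [cite: MazurRubin2004, Prop. 1.3.2 (p. 12)]
[cite: Howard2004HeegnerKolyvagin, Prop. 3.2.4] -/
theorem exists_inv_cupProduct_eq_sum_convCoeff
    {e : M →+ M' →+ DiscreteGaloisModule.MuCarrier K p}
    (ι : DiscreteGaloisModule.MuCarrier K p →+ ZMod p) (hι : Function.Injective ι)
    {v₀ : M} {w₀ : M'} (h1 : ι (e v₀ w₀) = 1)
    (hunr : GaloisRep.IsUnramifiedAt q ρ) (hunr' : GaloisRep.IsUnramifiedAt q ρ')
    (hqp : (p : 𝓞 K) ∉ q.asIdeal) (hpl : p ∣ Ideal.absNorm q.asIdeal - 1)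
    (hχI : ∀ u : (ZMod (Ideal.absNorm q.asIdeal))ˣ, ∃ t ∈ absInertia (q.adicCompletion K),
      modPCyclotomicCharacterZMod (q.adicCompletion K) (Ideal.absNorm q.asIdeal) t = u)
    {Fr : absoluteGaloisGroup (q.adicCompletion K)} (hFr : IsAbsArithFrob Fr)
    (hsplit : ρ (absGaloisRestrict K (q.adicCompletion K) Fr) = 1)
    (hsplit' : ρ' (absGaloisRestrict K (q.adicCompletion K) Fr) = 1) {m : ℕ} (hm : m + 1 ≤ J)
    (hFrm : absGaloisRestrict K (q.adicCompletion K) Fr ∈ κ.layerSubgroup m)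
    (hFrm' : absGaloisRestrict K (q.adicCompletion K) Fr ∉ κ.layerSubgroup (m + 1))
    {t₀ : absoluteGaloisGroup (q.adicCompletion K)} (ht₀ : t₀ ∈ absInertia (q.adicCompletion K))
    (hgen : ∀ u : (ZMod (Ideal.absNorm q.asIdeal))ˣ,
      u ∈ Subgroup.zpowers (modPCyclotomicCharacterZMod (q.adicCompletion K) (Ideal.absNorm q.asIdeal) t₀))
    (inv : LocalInvariants K p)
    (P : ContPairing (GaloisRep.toLocal q (κ.twistModP ρ hM J)).toTopRep
      (GaloisRep.toLocal q (κ.invTwist.twistModP ρ' hM' J)).toTopRep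
      ((DiscreteGaloisModule.mu K p).toLocal (Sum.inr q)).toTopRep)
    (hP : ∀ x y, P.toLin x y = gorensteinPairing e J x y)
    (S : (GaloisRep.toLocal q (κ.twistModP ρ hM J)).toContRepresentation →ⁱL
      (GaloisRep.toLocal q (κ.twistModP ρ hM J)).toContRepresentation)
    (hS : ∀ x, S x = shiftEnd M J x) :
    ∃ u : ℕ → ZMod p,
      ∀ k < J, ∀ (φ : contOneCocycles (GaloisRep.toLocal q (κ.twistModP ρ hM J)).toTopRep)
        (ψ : contOneCocycles (GaloisRep.toLocal q (κ.invTwist.twistModP ρ' hM' J)).toTopRep),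
        oneCocycleClass _ φ ∈ DiscreteGaloisModule.transverseSubgroup
          (GaloisRep.toLocal q (κ.twistModP ρ hM J))
          (CyclotomicField (Ideal.absNorm q.asIdeal) (q.adicCompletion K)) →
        (∀ t ∈ absInertia (q.adicCompletion K), ψ.1 t = 0) →
        inv (Sum.inr q) (P.cupProduct
            ((galoisCohomology.map S 1)^[J - 1 - k] (oneCocycleClass _ φ)) (oneCocycleClass _ ψ)) =
          ∑ j ∈ Finset.range (k + 1), u j * ι (convCoeff e J (k - j) (φ.1 t₀) (ψ.1 Fr)) := by
  classical
  have hJ : 0 < J := by omega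
  -- ### local facts at `q`
  have hchar := ringChar_residueField_adicCompletion_eq q
  have hFr1 : IsFrobPow Fr 1 := IsAbsArithFrob.isFrobPow_holds hFr
  have hI : ∀ t ∈ absInertia (q.adicCompletion K), ∀ x : Fin J → M,
      GaloisRep.toLocal q (κ.twistModP ρ hM J) t x = x :=
    fun _ ht x => toLocal_twistModP_apply_of_mem_absInertia ρ hM κ J q hunr hqp ht x
  have hI' : ∀ t ∈ absInertia (q.adicCompletion K), ∀ y : Fin J → M',
      GaloisRep.toLocal q (κ.invTwist.twistModP ρ' hM' J) t y = y :=
    fun _ ht y => toLocal_twistModP_apply_of_mem_absInertia ρ' hM' κ.invTwist J q hunr' hqp ht y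
  have hI'1 : ∀ t ∈ absInertia (q.adicCompletion K), GaloisRep.toLocal q (κ.invTwist.twistModP ρ' hM' J) t = 1 :=
    fun t ht => LinearMap.ext (hI' t ht)
  have hℓM : ∀ x : Fin J → M, (Ideal.absNorm q.asIdeal - 1) • x = 0 := sub_one_smul_eq_zero_of_dvd hM hpl
  -- ### the value parametrisations
  -- (X) transverse cocycles with value `S^{J−p^m} t` at `t₀`
  choose φt hφt_tr hφt_val using exists_transverse_cocycle_apply_eq ρ hM κ J q hunr hqp hpl hχI hFr
    hsplit hm hFrm hFrm' ht₀ hgen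
  -- (Y) unramified cocycles with value `f` at `Fr`
  choose ψf hψf_ur hψf_val using exists_unramified_cocycle_apply_frob_eq
    (GaloisRep.toLocal q (κ.invTwist.twistModP ρ' hM' J)) hI'1 hFr
  -- uniqueness of classes with given values
  have hXeq : ∀ (t : Fin J → M) (φ : contOneCocycles (GaloisRep.toLocal q (κ.twistModP ρ hM J)).toTopRep),
      oneCocycleClass _ φ ∈ DiscreteGaloisModule.transverseSubgroup (GaloisRep.toLocal q (κ.twistModP ρ hM J))
        (CyclotomicField (Ideal.absNorm q.asIdeal) (q.adicCompletion K)) →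
      φ.1 t₀ = (shiftEnd M J ^ (J - p ^ m)) t → oneCocycleClass _ φ = oneCocycleClass _ (φt t) :=
    fun t φ hφ hv => oneCocycleClass_eq_of_transverse_of_apply_eq ρ hM κ J q hunr hqp hpl hχI ht₀ hgen
      φ (φt t) hφ (hφt_tr t) (by rw [hv, hφt_val])
  have hYeq : ∀ (f : Fin J → M') (ψ : contOneCocycles (GaloisRep.toLocal q (κ.invTwist.twistModP ρ' hM' J)).toTopRep),
      (∀ t ∈ absInertia (q.adicCompletion K), ψ.1 t = 0) → ψ.1 Fr = f →
      oneCocycleClass _ ψ = oneCocycleClass _ (ψf f) :=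
    fun f ψ hψ hv => oneCocycleClass_eq_of_unramified_of_apply_frob_sub_mem _ hI'1 hFr ψ (ψf f) hψ
      (hψf_ur f) (m := 0) (by rw [hv, hψf_val, sub_self, map_zero, sub_zero])
  -- ### the class maps `X`, `Y`
  obtain ⟨X, hX⟩ : ∃ X : (Fin J → M) → galoisCohomology (GaloisRep.toLocal q (κ.twistModP ρ hM J)) 1,
      ∀ t, X t = oneCocycleClass _ (φt t) := ⟨_, fun _ => rfl⟩
  obtain ⟨Y, hY⟩ : ∃ Y : (Fin J → M') → galoisCohomology (GaloisRep.toLocal q (κ.invTwist.twistModP ρ' hM' J)) 1,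
      ∀ f, Y f = oneCocycleClass _ (ψf f) := ⟨_, fun _ => rfl⟩
  have hXtr : ∀ t, X t ∈ DiscreteGaloisModule.transverseSubgroup (GaloisRep.toLocal q (κ.twistModP ρ hM J))
      (CyclotomicField (Ideal.absNorm q.asIdeal) (q.adicCompletion K)) := fun t => by rw [hX]; exact hφt_tr t
  have hXadd : ∀ t t', X (t + t') = X t + X t' := by
    intro t t'
    have htr : oneCocycleClass _ (φt t + φt t') ∈ DiscreteGaloisModule.transverseSubgroup
        (GaloisRep.toLocal q (κ.twistModP ρ hM J))
        (CyclotomicField (Ideal.absNorm q.asIdeal) (q.adicCompletion K)) := by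
      rw [oneCocycleClass_add]; exact AddSubgroup.add_mem _ (hφt_tr t) (hφt_tr t')
    have h := hXeq (t + t') (φt t + φt t') htr
      (by rw [Submodule.coe_add, ContinuousMap.add_apply, hφt_val, hφt_val, map_add])
    rw [hX, hX, hX]
    exact h.symm.trans (oneCocycleClass_add _ _ _)
  have hX0 : ∀ t, (shiftEnd M J ^ (J - p ^ m)) t = 0 → X t = 0 := by
    intro t ht
    have htr : oneCocycleClass _ (0 : contOneCocycles (GaloisRep.toLocal q (κ.twistModP ρ hM J)).toTopRep) ∈
        DiscreteGaloisModule.transverseSubgroup (GaloisRep.toLocal q (κ.twistModP ρ hM J))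
        (CyclotomicField (Ideal.absNorm q.asIdeal) (q.adicCompletion K)) := by
      rw [oneCocycleClass_zero]; exact AddSubgroup.zero_mem _
    have h := hXeq t 0 htr (by rw [ht]; rfl)
    rw [hX]
    exact h.symm.trans (oneCocycleClass_zero _)
  have hYadd : ∀ f f', Y (f + f') = Y f + Y f' := by
    intro f f'
    have h := hYeq (f + f') (ψf f + ψf f')
      (fun t ht => by
        rw [Submodule.coe_add, ContinuousMap.add_apply, hψf_ur f t ht, hψf_ur f' t ht, add_zero])
      (by rw [Submodule.coe_add, ContinuousMap.add_apply, hψf_val, hψf_val])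
    rw [hY, hY, hY]
    exact h.symm.trans (oneCocycleClass_add _ _ _)
  -- ### opaque abbreviations: `mS = H¹(S)`, `cup a b = inv_q(a ∪_P b)` (keeps the goals small)
  obtain ⟨mS, hmS⟩ : ∃ mS : galoisCohomology (GaloisRep.toLocal q (κ.twistModP ρ hM J)) 1 →+
      galoisCohomology (GaloisRep.toLocal q (κ.twistModP ρ hM J)) 1, mS = galoisCohomology.map S 1 := ⟨_, rfl⟩
  obtain ⟨cup, hcup⟩ : ∃ cup : galoisCohomology (GaloisRep.toLocal q (κ.twistModP ρ hM J)) 1 →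
      galoisCohomology (GaloisRep.toLocal q (κ.invTwist.twistModP ρ' hM' J)) 1 → ZMod p,
      ∀ a b, cup a b = inv (Sum.inr q) (P.cupProduct a b) := ⟨_, fun _ _ => rfl⟩
  have hcup_add_left : ∀ a a' b, cup (a + a') b = cup a b + cup a' b := by
    intro a a' b
    rw [hcup, hcup, hcup]
    exact (congrArg (inv (Sum.inr q)) (LinearMap.congr_fun (map_add P.cupProduct a a') b)).trans
      (map_add (inv (Sum.inr q)) _ _)
  have hcup_add_right : ∀ a b b', cup a (b + b') = cup a b + cup a b' := by
    intro a b b'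
    rw [hcup, hcup, hcup]
    exact (congrArg (inv (Sum.inr q)) (map_add (P.cupProduct a) b b')).trans (map_add (inv (Sum.inr q)) _ _)
  have hcup_zero_left : ∀ b, cup 0 b = 0 := by
    intro b
    have h := hcup_add_left 0 0 b
    rw [add_zero] at h
    exact add_left_cancel (h.symm.trans (add_zero _).symm)
  -- ### the shifts on classes
  have hSit : ∀ (i : ℕ) (v : Fin J → M), (fun x => S x)^[i] v = (shiftEnd M J ^ i) v := by
    intro i v
    induction i with
    | zero => simp
    | succ i ih => rw [Function.iterate_succ_apply', ih, hS, pow_succ', Module.End.mul_apply]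
  have hXshift : ∀ (i : ℕ) (t : Fin J → M), (⇑mS)^[i] (X t) = X ((shiftEnd M J ^ i) t) := by
    intro i t
    obtain ⟨φ', h1, h2⟩ := map_iterate_oneCocycleClass _ S i (φt t)
    rw [hmS, hX, hX, h2]
    refine hXeq _ φ' ?_ ?_
    · rw [← h2]; exact iterate_map_mem_transverseSubgroup _ _ S i (hφt_tr t)
    · rw [h1, hSit, hφt_val, shiftEnd_pow_shiftEnd_pow_apply, shiftEnd_pow_shiftEnd_pow_apply, add_comm]
  have hXshift1 : ∀ t : Fin J → M, mS (X t) = X (shiftEnd M J t) := by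
    intro t
    have h := hXshift 1 t
    rwa [Function.iterate_one, pow_one] at h
  obtain ⟨S', hS'⟩ := exists_contIntertwiningMap_of_comm
    (GaloisRep.toLocal q (κ.invTwist.twistModP ρ' hM' J)) (GaloisRep.toLocal q (κ.invTwist.twistModP ρ' hM' J))
    (shiftEnd M' J).toAddMonoidHom
    (fun g y => ZpExtension.shiftEnd_twistModP_apply κ.invTwist ρ' hM' J _ y)
  have hYshift : ∀ f : Fin J → M', galoisCohomology.map S' 1 (Y f) = Y (shiftEnd M' J f) := by
    intro f
    obtain ⟨ψ', h1, h2⟩ := galoisCohomology_map_oneCocycleClass _ _ S' (ψf f)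
    rw [hY, hY, h2]
    refine hYeq _ ψ' ?_ ?_
    · intro t ht; rw [h1, hψf_ur f t ht, map_zero]
    · rw [h1, hψf_val, hS']; rfl
  -- ### adjointness of `S` / `S'` for the local cup product
  have hcupS : ∀ a b, cup (mS a) b = cup a (galoisCohomology.map S' 1 b) := by
    intro a b
    rw [hcup, hcup, hmS]
    exact congrArg (inv (Sum.inr q)) (ContPairing.cupProduct_adjoint P P
      (TopRep.ofHom ⟨S.toContinuousLinearMap, S.isIntertwining'⟩)
      (TopRep.ofHom ⟨S'.toContinuousLinearMap, S'.isIntertwining'⟩)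
      (fun x y => by
        change P.toLin (S x) y = P.toLin x (S' y)
        rw [hP, hP, hS, hS']
        exact gorensteinPairing_shiftEnd_comm e x y) a b)
  -- ### naturality for coordinatewise endomorphisms (`cupProduct_iterate_eq_of_adjoint`)
  have hnat : ∀ (φ₀ : M →+ M) (φ₀' : M' →+ M'), (∀ a b, e (φ₀ a) b = e a (φ₀' b)) →
      ∀ (i : ℕ) (t : Fin J → M) (f : Fin J → M'),
        cup ((⇑mS)^[i] (X fun j => φ₀ (t j))) (Y f) = cup ((⇑mS)^[i] (X t)) (Y fun j => φ₀' (f j)) := by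
    intro φ₀ φ₀' hadj i t f
    rw [hcup, hcup, hmS, hX, hX, hY, hY]
    exact congrArg (inv (Sum.inr q)) (cupProduct_iterate_eq_of_adjoint ρ ρ' hM hM' κ J q hunr hunr' hqp hpl
      hχI hFr hsplit hsplit' ht₀ hgen P hP S hS φ₀ φ₀' hadj (φt t) (φt fun j => φ₀ (t j)) (hφt_tr t) (hφt_tr _)
      (by rw [hφt_val, hφt_val]; exact shiftEnd_pow_comp_apply φ₀ _ t) (ψf f) (ψf fun j => φ₀' (f j))
      (hψf_ur f) (hψf_ur _) (by rw [hψf_val, hψf_val]) i)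
  -- ### the coefficient family `Φ_k(t, f) = inv_q(T^{J−1−k} X(t) ∪ Y(f))`
  obtain ⟨Φf, hΦf⟩ : ∃ Φf : ℕ → (Fin J → M) → (Fin J → M') → ZMod p, ∀ k t f,
      Φf k t f = cup ((⇑mS)^[J - 1 - k] (X t)) (Y f) := ⟨_, fun _ _ _ => rfl⟩
  have hΦf_add_right : ∀ k t f f', Φf k t (f + f') = Φf k t f + Φf k t f' := by
    intro k t f f'
    rw [hΦf, hΦf, hΦf, hYadd, hcup_add_right]
  have hΦf_add_left : ∀ k t t' f, Φf k (t + t') f = Φf k t f + Φf k t' f := by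
    intro k t t' f
    rw [hΦf, hΦf, hΦf, hXadd, iterate_map_add', hcup_add_left]
  obtain ⟨Φ, hΦ⟩ : ∃ Φ : ℕ → (Fin J → M) →+ (Fin J → M') →+ ZMod p, ∀ (k : ℕ) (t : Fin J → M) (f : Fin J → M'),
      Φ k t f = cup ((⇑mS)^[J - 1 - k] (X t)) (Y f) :=
    ⟨fun k => AddMonoidHom.mk' (fun t => AddMonoidHom.mk' (fun f => Φf k t f) (hΦf_add_right k t))
      (fun t t' => AddMonoidHom.ext fun f => hΦf_add_left k t t' f), fun k t f => hΦf k t f⟩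
  have hXzero : ∀ (a : ℕ) (x : Fin J → M), J ≤ a + (J - p ^ m) → X ((shiftEnd M J ^ a) x) = 0 := by
    intro a x ha
    refine hX0 _ ?_
    rw [shiftEnd_pow_shiftEnd_pow_apply]
    exact shiftEnd_pow_apply_eq_zero_of_le (by omega) x
  -- shift-compatibility
  have hLs : ∀ (k : ℕ) (x : Fin J → M) (y : Fin J → M'), k + 1 < J →
      Φ (k + 1) (shiftEnd M J x) y = Φ k x y := by
    intro k x y hk
    obtain ⟨n, hn1, hn2⟩ : ∃ n, J - 1 - (k + 1) = n ∧ J - 1 - k = n + 1 := ⟨J - 1 - (k + 1), rfl, by omega⟩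
    rw [hΦ, hΦ, hn1, hn2, Function.iterate_succ_apply (⇑mS) n (X x), hXshift1 x]
  have hL0 : ∀ (x : Fin J → M) (y : Fin J → M'), Φ 0 (shiftEnd M J x) y = 0 := by
    intro x y
    rw [hΦ, hXshift, shiftEnd_pow_shiftEnd_apply, hXzero _ x (by omega), hcup_zero_left]
  have hRs : ∀ (k : ℕ) (x : Fin J → M) (y : Fin J → M'), k + 1 < J →
      Φ (k + 1) x (shiftEnd M' J y) = Φ k x y := by
    intro k x y hk
    obtain ⟨n, hn1, hn2⟩ : ∃ n, J - 1 - (k + 1) = n ∧ J - 1 - k = n + 1 := ⟨J - 1 - (k + 1), rfl, by omega⟩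
    rw [hΦ, hΦ, hn1, hn2, Function.iterate_succ_apply' (⇑mS) n (X x), hcupS, hYshift y]
  have hR0 : ∀ (x : Fin J → M) (y : Fin J → M'), Φ 0 x (shiftEnd M' J y) = 0 := by
    intro x y
    rw [hΦ, ← hYshift y, ← hcupS, hXshift, hXshift1, shiftEnd_shiftEnd_pow_apply,
      hXzero _ x (by omega), hcup_zero_left]
  -- ### values on constant vectors: rank-one naturality (Schur)
  -- the `ℤ/p`-valued pairing `e' = ι ∘ e`
  obtain ⟨e', he'⟩ : ∃ e' : M →+ M' →+ ZMod p, ∀ a b, e' a b = ι (e a b) :=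
    ⟨AddMonoidHom.mk' (fun a => ι.comp (e a)) (fun a a' => AddMonoidHom.ext fun b => by
      simp only [AddMonoidHom.comp_apply, map_add, AddMonoidHom.add_apply]), fun _ _ => rfl⟩
  have hPi : ∀ (φ₀ : M →+ M) (a : M),
      (fun j => φ₀ ((Pi.single (⟨0, hJ⟩ : Fin J) a : Fin J → M) j)) = Pi.single (⟨0, hJ⟩ : Fin J) (φ₀ a) := by
    intro φ₀ a
    funext j
    by_cases hj : j = ⟨0, hJ⟩
    · subst hj; rw [Pi.single_eq_same, Pi.single_eq_same]
    · rw [Pi.single_eq_of_ne hj, Pi.single_eq_of_ne hj, map_zero]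
  have hPi' : ∀ (φ₀' : M' →+ M') (b : M'),
      (fun j => φ₀' ((Pi.single (⟨0, hJ⟩ : Fin J) b : Fin J → M') j)) = Pi.single (⟨0, hJ⟩ : Fin J) (φ₀' b) := by
    intro φ₀' b
    funext j
    by_cases hj : j = ⟨0, hJ⟩
    · subst hj; rw [Pi.single_eq_same, Pi.single_eq_same]
    · rw [Pi.single_eq_of_ne hj, Pi.single_eq_of_ne hj, map_zero]
  set u : ℕ → ZMod p := fun k => Φ k (Pi.single (⟨0, hJ⟩ : Fin J) v₀) (Pi.single (⟨0, hJ⟩ : Fin J) w₀) with hu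
  have hδ : ∀ k < J, ∀ (a : M) (b : M') (h0 : 0 < J),
      Φ k (Pi.single (⟨0, h0⟩ : Fin J) a) (Pi.single (⟨0, h0⟩ : Fin J) b) = u k * e' a b := by
    intro k hk a b h0
    -- the rank-one pair `φ₀ = e'(·, w₀)•a`, `φ₀' = e'(a, ·)•w₀`
    let φ₀ : M →+ M :=
      { toFun := fun x => (ι (e x w₀)).val • a
        map_zero' := by rw [map_zero, AddMonoidHom.zero_apply, map_zero, ZMod.val_zero, zero_smul]
        map_add' := fun x x' => by
          rw [map_add, AddMonoidHom.add_apply, map_add]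
          exact val_add_nsmul (hM a) _ _ }
    let φ₀' : M' →+ M' :=
      { toFun := fun y => (ι (e a y)).val • w₀
        map_zero' := by rw [map_zero, map_zero, ZMod.val_zero, zero_smul]
        map_add' := fun y y' => by
          rw [map_add, map_add]
          exact val_add_nsmul (hM' w₀) _ _ }
    have hφ₀ : ∀ x, φ₀ x = (ι (e x w₀)).val • a := fun _ => rfl
    have hφ₀' : ∀ y, φ₀' y = (ι (e a y)).val • w₀ := fun _ => rfl
    have hadj : ∀ x y, e (φ₀ x) y = e x (φ₀' y) := by
      intro x y
      apply hι
      rw [hφ₀, hφ₀', map_nsmul, AddMonoidHom.nsmul_apply, (e x).map_nsmul, map_val_nsmul_eq_mul,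
        map_val_nsmul_eq_mul, mul_comm]
    have h := hnat φ₀ φ₀' hadj (J - 1 - k) (Pi.single (⟨0, h0⟩ : Fin J) v₀) (Pi.single (⟨0, h0⟩ : Fin J) b)
    rw [hPi, hPi', hφ₀, hφ₀', h1, ZMod.val_one, one_smul, ← hΦ, ← hΦ] at h
    have hsn : ∀ (n : ℕ) (b' : M'),
        (Pi.single (⟨0, hJ⟩ : Fin J) (n • b') : Fin J → M') = n • Pi.single (⟨0, hJ⟩ : Fin J) b' := by
      intro n b'
      funext j
      rw [Pi.smul_apply]
      by_cases hj : j = ⟨0, hJ⟩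
      · subst hj; rw [Pi.single_eq_same, Pi.single_eq_same]
      · rw [Pi.single_eq_of_ne hj, Pi.single_eq_of_ne hj, smul_zero]
    rw [h, hsn, map_nsmul, nsmul_eq_mul, ZMod.natCast_zmod_val, he', mul_comm]
  -- ### the family is `u(T)·(Gorenstein family)`
  have hfam : ∀ k < J, ∀ (x : Fin J → M) (y : Fin J → M'),
      Φ k x y = ∑ j ∈ Finset.range (k + 1), u j * convCoeff e' J (k - j) x y :=
    fun k hk x y => family_eq_weightedConv e' u Φ hL0 hLs hR0 hRs hδ hk x y
  -- ### `u_j = 0` for `j < s := J − p^m`: the transverse value `T^s t` has no coefficient below `s`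
  have hu_zero : ∀ j, j < J - p ^ m → u j = 0 := by
    intro j hj
    rw [hu]
    change Φ j _ _ = 0
    rw [hΦ, hXshift, hXzero _ _ (by omega), hcup_zero_left]
  -- the convolution coefficients of `e'` are `ι` of those of `e`, and shift on the left by `a` places
  have hconv : ∀ (i : ℕ) (x : Fin J → M) (y : Fin J → M'), convCoeff e' J i x y = ι (convCoeff e J i x y) := by
    intro i x y
    rw [convCoeff_def, convCoeff_def, map_sum]
    exact Finset.sum_congr rfl fun a _ => he' _ _
  have hCshift : ∀ (a : ℕ) {k : ℕ}, k < J → ∀ (x : Fin J → M) (y : Fin J → M'),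
      convCoeff e J k ((shiftEnd M J ^ a) x) y = if a ≤ k then convCoeff e J (k - a) x y else 0 :=
    fun a k hk x y => convCoeff_shiftEnd_pow_left_eq' e a hk x y
  -- ### the IDENTITY for arbitrary transverse / unramified cocycles, with the shifted unit `k ↦ u (s + k)`
  have hmain : ∀ k < J, ∀ (φ : contOneCocycles (GaloisRep.toLocal q (κ.twistModP ρ hM J)).toTopRep)
      (ψ : contOneCocycles (GaloisRep.toLocal q (κ.invTwist.twistModP ρ' hM' J)).toTopRep),
      oneCocycleClass _ φ ∈ DiscreteGaloisModule.transverseSubgroup (GaloisRep.toLocal q (κ.twistModP ρ hM J))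
        (CyclotomicField (Ideal.absNorm q.asIdeal) (q.adicCompletion K)) →
      (∀ t ∈ absInertia (q.adicCompletion K), ψ.1 t = 0) →
      cup ((⇑mS)^[J - 1 - k] (oneCocycleClass _ φ)) (oneCocycleClass _ ψ) =
        ∑ j ∈ Finset.range (k + 1), u (J - p ^ m + j) * ι (convCoeff e J (k - j) (φ.1 t₀) (ψ.1 Fr)) := by
    intro k hk φ ψ hφ hψ
    obtain ⟨t, ht⟩ := cocycle_apply_mem_range_shiftEnd_pow ρ hM κ J q hunr hqp hpl hχI hsplit hm hFrm hFrm' φ ht₀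
    have hφX : oneCocycleClass _ φ = X t := by rw [hX]; exact hXeq t φ hφ ht
    have hψY : oneCocycleClass _ ψ = Y (ψ.1 Fr) := by rw [hY]; exact hYeq _ ψ hψ rfl
    rw [hφX, hψY, ← hΦ, hfam k hk, ht]
    refine sum_range_mul_shift_reindex u (fun i => ι (convCoeff e J i t (ψ.1 Fr)))
      (fun i => ι (convCoeff e J i ((shiftEnd M J ^ (J - p ^ m)) t) (ψ.1 Fr))) (J - p ^ m) k hu_zero ?_
      |>.symm.trans ?_ |>.symm
    · intro i hi
      simp only []
      rw [hCshift _ (by omega)]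
      split_ifs <;> simp
    · exact Finset.sum_congr rfl fun j _ => by rw [hconv]
  -- ### conclusion
  exact ⟨fun j => u (J - p ^ m + j), fun k hk φ ψ hφ hψ => by
    rw [← hmS, ← hcup]
    exact hmain k hk φ ψ hφ hψ⟩


end QTerm

end Summit.BirchSwinnertonDyer.BirchSwinnertonDyer.Rank1Residual.LocalSplitPrime

end
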